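import Summits.ResolutionOfSingularities.ResolutionOfSingularities.Theorems.WallAlgebra
import Summits.ResolutionOfSingularities.ResolutionOfSingularities.Theorems.WeightedInvariantIota3FlagTools
import HarnessLib

/-!
# WallAlgebra2 — decomp-res node «WallCut» (lens-4 g30, critic rows 176/176a CLEARED DECIDED +1), tree file 2/8 of the node

Content VERBATIM from the decomp-res lens-4 g30 node `HOME/decomp-res-lens-4/g30/WallCut.lean` (pin c43ccc48;
imports the landed tree only, carries nothing);
HOME = run/shared/lean/pub/decomp-res; critic rows 176/176a CLEARED DECIDED +1; landing orders INBOX :819 —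
provenance, critic text and the lens header in full in the first file of the
node, `WallAlgebra`.  Namespace `…Theorems.HugValuationCut`; `--supports stmt-ResolutionOfSingularities-28338`.

## This file

Continuation 2/2 of `WallAlgebra` (same section of the node, cut at the 400-line cap): carries
`chart_ideal_eq_of_rational`, `isRsopPart_triple_of_span_eq`.

[WRITER NOTE (decomp-res writer g11): file split only (tree files ≤ 400 lines); namespace, universes, sections,
section variables and every declaration
exactly as in the lens (the node's global dupNamespace-linter line is dropped — the library sets it; the `open
…Theses` line lives only in the Theses-cone file;
`set_option maxHeartbeats … in` prefixes of single declarations are kept VERBATIM).  ONE deletion (gate dedup rule,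
critic :835 watch-list): the node's private copy of
isUnit_add_of_mem_maximalIdeal` is NOT re-landed — it is LITERALLY the landed
`Literature.AlgebraicGeometry.Resolution.isUnit_add_of_mem_maximalIdeal` (`WeightedInitialTerms`,
imported; the namespace is opened as in the lens), which the transport proofs now cite by the same short name.
SECOND deletion (gate dedup bounce p810318):
the node's `range_triple` is NOT re-landed — it is LITERALLY the landed
`…Cruxes.HypersurfaceCentreConstruction.LocalEngine.Iota3.range_vec₃`
(`Theorems/WeightedInvariantIota3FlagTools`, imported from `WallAlgebra2` on; aliased by an explicit `open …
(range_vec₃)`), cited by name at its two uses.]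

(Sources: Hauser2010Kangaroo (arXiv:0811.4151, Kangaroo Theorem condition (3)); HauserPerlega2019 §2; Hauser2024
PRIMS 60; Moh1987; Perlega2023; Matsumura1987 Thms. 14.2–14.3, 19.x; ZariskiSamuel1960 VIII §11; StacksProject Tags
0804, 0BIQ, 00NQ, 0AGS; DeJong1996 2.4; CossartPiltant2008 §2; Giraud1975.)
-/

noncomputable section

open CategoryTheory AlgebraicGeometry IsLocalRing
open Literature.AlgebraicGeometry.Resolution
open Summit.ResolutionOfSingularities.ResolutionOfSingularities.Theorems
open WeakOrderReduction ForcedTowerClasses DivergentTowerClasses MonomialTowerClasses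
open HugDimensionClasses HugDimensionKernels SurfaceShadowClasses SurfaceShadowKernels
open NearPointCut (SingularClass)
open scoped BigOperators
open Summit.ResolutionOfSingularities.ResolutionOfSingularities.Cruxes.HypersurfaceCentreConstruction.LocalEngine.Iota3 (range_vec₃)

namespace Summit.ResolutionOfSingularities.ResolutionOfSingularities.Theorems.HugValuationCut

section FreeAlgebra

universe u
variable {R : Type u} [CommRing R] {n : ℕ} (c : Fin n → R) (i : Fin n)

/-- **RATIONAL POINTS OF THE EXCEPTIONAL DIVISOR (KERNEL, PROVED).** For the blow-up chart `B = R[𝔪/c_i]` of a local ring `R` at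
its maximal ideal `𝔪 = (c)`, and an ideal `𝔴 ≠ ⊤` of `B` over `𝔪` containing `e_j − λ_j` (`λ_j ∈ R`) for every chart generator
`e_j`: `𝔴 = (c_i) + (e_j − λ_j)_j` — every element of `B` is a polynomial in the `e_j` over `R`, congruent to its value at `λ`,
which lies in `𝔪 ⊆ (c_i)` or is a unit. (Sources: StacksProject, Tag 0BIQ.) -/
theorem chart_ideal_eq_of_rational [IsLocalRing R] (hc : Ideal.span (Set.range c) = maximalIdeal R)
    (𝔴 : Ideal (chartRing c i)) (h𝔴 : 𝔴.comap (chartBase c i) = maximalIdeal R) (htop : 𝔴 ≠ ⊤)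
    (lam : {j : Fin n // j ≠ i} → R) (hlam : ∀ j, chartGen c i j.1 - chartBase c i (lam j) ∈ 𝔴) :
    𝔴 = Ideal.span {chartBase c i (c i)} ⊔
      Ideal.span (Set.range fun j : {j : Fin n // j ≠ i} => chartGen c i j.1 - chartBase c i (lam j)) := by
  have hQ𝔴 : Ideal.span {chartBase c i (c i)} ⊔
      Ideal.span (Set.range fun j : {j : Fin n // j ≠ i} => chartGen c i j.1 - chartBase c i (lam j)) ≤ 𝔴 := by
    refine sup_le ?_ ?_
    · rw [Ideal.span_le, Set.singleton_subset_iff]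
      have h1 : c i ∈ 𝔴.comap (chartBase c i) := by rw [h𝔴, ← hc]; exact Ideal.subset_span ⟨i, rfl⟩
      exact h1
    · rw [Ideal.span_le]
      rintro _ ⟨j, rfl⟩
      exact hlam j
  refine le_antisymm (fun b hb => ?_) hQ𝔴
  obtain ⟨p, hp⟩ := eval₂Hom_chartGen_surjective c i b
  have hbp : b = MvPolynomial.eval₂Hom (chartBase c i) (fun j => chartGen c i j.1) p := hp.symm
  subst hbp
  have hQ : ∀ j : {j : Fin n // j ≠ i}, chartGen c i j.1 - chartBase c i (lam j) ∈ Ideal.span {chartBase c i (c i)} ⊔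
      Ideal.span (Set.range fun j : {j : Fin n // j ≠ i} => chartGen c i j.1 - chartBase c i (lam j)) :=
    fun j => Ideal.mem_sup_right (Ideal.subset_span ⟨j, rfl⟩)
  have hdiff := eval₂Hom_chartGen_sub_mem c i lam _ hQ p
  by_cases hr : MvPolynomial.eval lam p ∈ maximalIdeal R
  · have hφr : chartBase c i (MvPolynomial.eval lam p) ∈ Ideal.span {chartBase c i (c i)} ⊔
        Ideal.span (Set.range fun j : {j : Fin n // j ≠ i} => chartGen c i j.1 - chartBase c i (lam j)) :=
      Ideal.mem_sup_left (reesChartBase_mem_span_of_mem c i (by rw [hc]; exact hr))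
    have e1 : MvPolynomial.eval₂Hom (chartBase c i) (fun j => chartGen c i j.1) p =
        (MvPolynomial.eval₂Hom (chartBase c i) (fun j => chartGen c i j.1) p -
          chartBase c i (MvPolynomial.eval lam p)) + chartBase c i (MvPolynomial.eval lam p) := by ring
    rw [e1]
    exact Ideal.add_mem _ hdiff hφr
  · exfalso
    apply htop
    have hu : IsUnit (chartBase c i (MvPolynomial.eval lam p)) := by
      have h1 : IsUnit (MvPolynomial.eval lam p) := by
        by_contra h2
        exact hr ((IsLocalRing.mem_maximalIdeal _).mpr (mem_nonunits_iff.mpr h2))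
      exact h1.map _
    have hmem : chartBase c i (MvPolynomial.eval lam p) ∈ 𝔴 := by
      have e1 : chartBase c i (MvPolynomial.eval lam p) = MvPolynomial.eval₂Hom (chartBase c i) (fun j => chartGen c i j.1) p -
          (MvPolynomial.eval₂Hom (chartBase c i) (fun j => chartGen c i j.1) p -
            chartBase c i (MvPolynomial.eval lam p)) := by ring
      rw [e1]
      exact 𝔴.sub_mem hb (hQ𝔴 hdiff)
    exact Ideal.eq_top_of_isUnit_mem _ hmem hu

/-- three generators of the maximal ideal of a regular local ring of dimension `≥ 3` form a regular system of parameters.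
(Sources: Matsumura1987, Thm. 14.2.) -/
theorem isRsopPart_triple_of_span_eq [IsRegularLocalRing R] {a b d : R} (h : Ideal.span {a, b, d} = maximalIdeal R)
    (hdim : (3 : WithBot ℕ∞) ≤ ringKrullDim R) : IsRsopPart ![a, b, d] := by
  have h1 : ((maximalIdeal R).spanFinrank : WithBot ℕ∞) = ringKrullDim R := IsRegularLocalRing.spanFinrank_maximalIdeal
  have h2 : (maximalIdeal R).spanFinrank ≤ 3 := by
    rw [← h]
    refine (Submodule.spanFinrank_span_le_ncard_of_finite (by simp : ({a, b, d} : Set R).Finite)).trans ?_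
    refine (Set.ncard_insert_le _ _).trans ?_
    have h3 := Set.ncard_insert_le b ({d} : Set R)
    rw [Set.ncard_singleton] at h3
    omega
  have h3 : ringKrullDim R = ((3 + 0 : ℕ) : WithBot ℕ∞) := by
    refine le_antisymm ?_ (by simpa using hdim)
    rw [← h1]
    exact_mod_cast h2
  refine ⟨inferInstance, 0, Fin.elim0, h3, ?_⟩
  rw [range_vec₃, Set.range_eq_empty, Set.union_empty, h]

end FreeAlgebra

end Summit.ResolutionOfSingularities.ResolutionOfSingularities.Theorems.HugValuationCut
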